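import Summits.AtomisticToContinuum.Crystallization.Theorems.ChartedZeroExcessLayeredLatticeLiouvilleZR

/-!
# Part ZS «The skew class split: plane-registered | transverse» (lens-2 g79, NODE 79 rider 2; sequel of `…LatticeLiouvilleZR`)

The open class (L2-C⟂′) `CoolShadowLinearChartSkewP` (part ZR) is cut once more, by a GEOMETRIC predicate of the registration that does not depend on the
indexing of the layers: all skeleton layers of `LayeredHom L' w'` are translates of the one plane `L' (span {t₁, t₂})`, and two layer indices `m, m'` name
the SAME geometric plane iff `w' m − w' m' ∈ span {L' t₁, L' t₂}`.

* `IsPlaneReg` — PLANE-REGISTERED: any two `ε`-partners (in the skeleton) of two moat atoms of the SAME chart sheet lie in the same geometric layer plane.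
  This is regime (I) of the memo: the crystal's planes are registered sheet-to-plane, but the site set of a plane need not be ONE coset of the layer lattice
  (several cosets, displaced against each other by `≤ 10⁻⁴`-size wobbles) — the configurations for which (L2-C)'s `η`-wiggle is needed and SUFFICES with
  PER-SHEET origins `o` (no control of the crystal's inter-layer offsets is required).
* its negation — TRANSVERSE, regime (T): some sheet has partners in two distinct parallel planes of the crystal, so the sheet-compatible chart `Ψ'` of (L2-C)
  must slice the crystal TRANSVERSALLY to its own layers; besides the metric FLATNESS lemma (letter `c` forced) this needs the crystal's inter-layer offsets
  to be AFFINE to accuracy `≈ η` across the `≈ 45` layers meeting the `RC`-ball — an input of the type (F-hollow) «equilibrium charts are exactly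
  hollow-stacked» (part TM's wanted sub-fact; NOT in the tree), transported to the crystal by `EnvClose` at `ϑr = 10⁻⁴`.

Pieces (L2-C⟂′∥) `CoolShadowLinearChartSkewPlaneP` and (L2-C⟂′T) `CoolShadowLinearChartSkewTransP`; junction `skew_of_plane_trans` and EQUIV `skew_iff_plane_trans`
(PROVED, formal); record junction `bondLabelP_record_of_plane_trans`: (GL) ⟸ (L2-S) ∧ (L2-C⟂′∥) ∧ (L2-C⟂′T).  0 sorry; standard axioms.
-/

noncomputable section
open scoped BigOperators Classical InnerProductSpace RealInnerProductSpace
open MeasureTheory Set Metric Filter Topology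
open Summit.AtomisticToContinuum.Crystallization.Theorems.ChartedPlanarOrderRigidityDoor (E3 IsClean IsCharted)
open Summit.AtomisticToContinuum.Crystallization.Theorems.ChartedPlanarOrderDensityDichotomy (μS IsSep)
open Summit.AtomisticToContinuum.Crystallization.Theorems.ChartedPlanarOrderCleanScaleP (IsCleanP IsDoorSetP isCleanP_one_iff isCleanP_μS_iff)
open Summit.AtomisticToContinuum.Crystallization.Theorems.ChartedPlanarOrderMesoCut (LayeredHom EnvClose)
open Summit.AtomisticToContinuum.Crystallization.Theorems.ChartedPlanarOrderDoorLayeredOsc (IsTwoShellAffineGood mem_iff_μS_singleton_ne_zero)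
open Literature.MathematicalPhysics.StatisticalMechanics (lennardJones triangularVec₁ triangularVec₂)
open Literature.Geometry.DiscreteGeometry (IsTwoShellGoodSet)

namespace Summit.AtomisticToContinuum.Crystallization.Theorems.ChartedZeroExcessLayeredLatticeLiouville

/-! ## ZS-1  Plane registration -/

/-- the direction plane of the skeleton layers of `LayeredHom L' w'` (before placing): `span {L' t₁, L' t₂}`. -/
def layerSpan (L' : E3 →L[ℝ] E3) : Submodule ℝ E3 :=
  Submodule.span ℝ {L' (triangularVec₁ 1), L' (triangularVec₂ 1)}

/-- ★ **PLANE-REGISTERED**: any two skeleton `ε`-partners of two moat atoms of one chart sheet lie in the same geometric layer plane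
(`w' m − w' m' ∈ layerSpan L'`) — the registration is sheet-to-PLANE, whatever the indexing of the cosets inside a plane. -/
def IsPlaneReg (ε r ℓ : ℝ) (S K : Set E3) (Ψ : ℤ × ℤ × ℤ → E3) (L' : E3 →L[ℝ] E3) (w' : ℤ → E3) (U : E3 ≃ₗᵢ[ℝ] E3) (t : E3) : Prop :=
  ∀ x x' : ℤ × ℤ × ℤ, x.1 = x'.1 → Ψ x ∈ moatIn S K r ℓ → Ψ x' ∈ moatIn S K r ℓ →
    ∀ y y' : ℤ × ℤ × ℤ, dist (Ψ x) (placedSkel L' w' U t y) ≤ ε → dist (Ψ x') (placedSkel L' w' U t y') ≤ ε → w' y.1 - w' y'.1 ∈ layerSpan L'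

/-! ## ZS-2  The two pieces of the skew class and their junction -/

/-- ★★ (L2-C⟂′∥) PLANE-REGISTERED SKEW [open; regime (I): parallel planes, non-coset site sets; `η`-engine with per-sheet origins, no offset control]. -/
def CoolShadowLinearChartSkewPlaneP (ϑc ϑp r q rsh rm σ ϑr Rs ε rI ℓ aHi Λ θ s R₁ RC η : ℝ) : Prop :=
  CoolShadowLinearChartUnderP
    (fun S K Ψ L' w' U t => K.Nonempty ∧ ¬ IsReparallel ε r ℓ S K Ψ L' w' U t ∧ IsPlaneReg ε r ℓ S K Ψ L' w' U t)
    ϑc ϑp r q rsh rm σ ϑr Rs ε rI ℓ aHi Λ θ s R₁ RC η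

/-- ★★ (L2-C⟂′T) TRANSVERSE SKEW [open; regime (T): some sheet meets two layer planes; flatness lemma + affine inter-layer offsets needed]. -/
def CoolShadowLinearChartSkewTransP (ϑc ϑp r q rsh rm σ ϑr Rs ε rI ℓ aHi Λ θ s R₁ RC η : ℝ) : Prop :=
  CoolShadowLinearChartUnderP
    (fun S K Ψ L' w' U t => K.Nonempty ∧ ¬ IsReparallel ε r ℓ S K Ψ L' w' U t ∧ ¬ IsPlaneReg ε r ℓ S K Ψ L' w' U t)
    ϑc ϑp r q rsh rm σ ϑr Rs ε rI ℓ aHi Λ θ s R₁ RC η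

/-- ★★ JUNCTION (PROVED): (L2-C⟂′) ⟸ (L2-C⟂′∥) ∧ (L2-C⟂′T). [this file] -/
theorem skew_of_plane_trans {ϑc ϑp r q rsh rm σ ϑr Rs ε rI ℓ aHi Λ θ s R₁ RC η : ℝ}
    (hP : CoolShadowLinearChartSkewPlaneP ϑc ϑp r q rsh rm σ ϑr Rs ε rI ℓ aHi Λ θ s R₁ RC η)
    (hT : CoolShadowLinearChartSkewTransP ϑc ϑp r q rsh rm σ ϑr Rs ε rI ℓ aHi Λ θ s R₁ RC η) :
    CoolShadowLinearChartSkewP ϑc ϑp r q rsh rm σ ϑr Rs ε rI ℓ aHi Λ θ s R₁ RC η := by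
  intro δ hδ a ha S hSd hsum hgood L w hL x₀ K hKS hKq hTp hTc L' w' U t hcr Ψ τ hΨ hsurj hcase
  by_cases h : IsPlaneReg ε r ℓ S K Ψ L' w' U t
  · exact hP δ hδ a ha S hSd hsum hgood L w hL x₀ K hKS hKq hTp hTc L' w' U t hcr Ψ τ hΨ hsurj ⟨hcase.1, hcase.2, h⟩
  · exact hT δ hδ a ha S hSd hsum hgood L w hL x₀ K hKS hKq hTp hTc L' w' U t hcr Ψ τ hΨ hsurj ⟨hcase.1, hcase.2, h⟩

/-- both pieces are WEAKER than (L2-C⟂′). [formal bookkeeping] -/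
theorem plane_of_skew {ϑc ϑp r q rsh rm σ ϑr Rs ε rI ℓ aHi Λ θ s R₁ RC η : ℝ}
    (h : CoolShadowLinearChartSkewP ϑc ϑp r q rsh rm σ ϑr Rs ε rI ℓ aHi Λ θ s R₁ RC η) :
    CoolShadowLinearChartSkewPlaneP ϑc ϑp r q rsh rm σ ϑr Rs ε rI ℓ aHi Λ θ s R₁ RC η :=
  under_mono_case (fun S K Ψ L' w' U t
      (hQ : K.Nonempty ∧ ¬ IsReparallel ε r ℓ S K Ψ L' w' U t ∧ IsPlaneReg ε r ℓ S K Ψ L' w' U t) => ⟨hQ.1, hQ.2.1⟩) h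

/-- both pieces are WEAKER than (L2-C⟂′). [formal bookkeeping] -/
theorem trans_of_skew {ϑc ϑp r q rsh rm σ ϑr Rs ε rI ℓ aHi Λ θ s R₁ RC η : ℝ}
    (h : CoolShadowLinearChartSkewP ϑc ϑp r q rsh rm σ ϑr Rs ε rI ℓ aHi Λ θ s R₁ RC η) :
    CoolShadowLinearChartSkewTransP ϑc ϑp r q rsh rm σ ϑr Rs ε rI ℓ aHi Λ θ s R₁ RC η :=
  under_mono_case (fun S K Ψ L' w' U t
      (hQ : K.Nonempty ∧ ¬ IsReparallel ε r ℓ S K Ψ L' w' U t ∧ ¬ IsPlaneReg ε r ℓ S K Ψ L' w' U t) => ⟨hQ.1, hQ.2.1⟩) h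

/-- ★★ EQUIV LAYER: (L2-C⟂′) ⟺ (L2-C⟂′∥) ∧ (L2-C⟂′T). [this file] -/
theorem skew_iff_plane_trans (ϑc ϑp r q rsh rm σ ϑr Rs ε rI ℓ aHi Λ θ s R₁ RC η : ℝ) :
    CoolShadowLinearChartSkewP ϑc ϑp r q rsh rm σ ϑr Rs ε rI ℓ aHi Λ θ s R₁ RC η ↔
      CoolShadowLinearChartSkewPlaneP ϑc ϑp r q rsh rm σ ϑr Rs ε rI ℓ aHi Λ θ s R₁ RC η ∧
        CoolShadowLinearChartSkewTransP ϑc ϑp r q rsh rm σ ϑr Rs ε rI ℓ aHi Λ θ s R₁ RC η :=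
  ⟨fun h => ⟨plane_of_skew h, trans_of_skew h⟩, fun h => skew_of_plane_trans h.1 h.2⟩

/-! ## ZS-3  At the record -/

/-- ★★★ **JUNCTION OF RECORD IN THREE OPEN PIECES (PROVED)**: (GL) ⟸ (L2-S)(14, 57/4, 82/5) ∧ (L2-C⟂′∥)(82/5, 821/50, 1/100) ∧ (L2-C⟂′T)(82/5, 821/50, 1/100).
[this file] -/
theorem bondLabelP_record_of_plane_trans (ϑc : ℝ)
    (hPin : DoorChartPinningP ϑc (1 / 10) 8 4 12 16 (17 / 20) (1 / 10000) 5 (1 / 10000) 10 (43 / 2) 1 2 (1 / 16) (1 / 50)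
      14 (57 / 4) (82 / 5))
    (hP : CoolShadowLinearChartSkewPlaneP ϑc (1 / 10) 8 4 12 16 (17 / 20) (1 / 10000) 5 (1 / 10000) 10 (43 / 2) 1 2 (1 / 16) (1 / 50)
      (82 / 5) (821 / 50) (1 / 100))
    (hT : CoolShadowLinearChartSkewTransP ϑc (1 / 10) 8 4 12 16 (17 / 20) (1 / 10000) 5 (1 / 10000) 10 (43 / 2) 1 2 (1 / 16) (1 / 50)
      (82 / 5) (821 / 50) (1 / 100)) :
    BondLabelP ϑc (1 / 10) 8 4 12 16 (17 / 20) (1 / 10000) 5 (1 / 10000) 10 (43 / 2) 1 2 (1 / 16) (1 / 50) :=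
  bondLabelP_record_of_skew ϑc hPin (skew_of_plane_trans hP hT)

/-- the two pieces at `RC' = 821/50` follow from NODE 78's record (L2-C)(82/5, 33/2, 1/100). [formal bookkeeping] -/
theorem plane_trans_record_of_coolShadowLinearChartP_record (ϑc : ℝ)
    (h : CoolShadowLinearChartP ϑc (1 / 10) 8 4 12 16 (17 / 20) (1 / 10000) 5 (1 / 10000) 10 (43 / 2) 1 2 (1 / 16) (1 / 50)
      (82 / 5) (33 / 2) (1 / 100)) :
    CoolShadowLinearChartSkewPlaneP ϑc (1 / 10) 8 4 12 16 (17 / 20) (1 / 10000) 5 (1 / 10000) 10 (43 / 2) 1 2 (1 / 16) (1 / 50)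
        (82 / 5) (821 / 50) (1 / 100) ∧
      CoolShadowLinearChartSkewTransP ϑc (1 / 10) 8 4 12 16 (17 / 20) (1 / 10000) 5 (1 / 10000) 10 (43 / 2) 1 2 (1 / 16) (1 / 50)
        (82 / 5) (821 / 50) (1 / 100) :=
  (skew_iff_plane_trans _ _ _ _ _ _ _ _ _ _ _ _ _ _ _ _ _ _ _).1 (skew_record_of_coolShadowLinearChartP_record ϑc h)

end Summit.AtomisticToContinuum.Crystallization.Theorems.ChartedZeroExcessLayeredLatticeLiouville
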